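import Mathlib.LinearAlgebra.Dual.Lemmas
import Mathlib.LinearAlgebra.Basis.Bilinear
import Mathlib.LinearAlgebra.FiniteDimensional.Lemmas
import HarnessLib

/-!
# A `𝔤𝔩(U)`-stable space of bilinear forms on a `3`-space is symmetric, alternating, or everything
# (the decomposition `U^* ⊗ U^* = Sym² U^* ⊕ Λ² U^*` into non-isomorphic irreducibles, elementary form)

Topic `Literature/Algebra/Lie`, namespace `Literature.Algebra.Lie`. THEOREMS only (no definition, no named fact, no `sorry`).

SETTING: `K` a field of characteristic `0`, `U` a `K`-space of dimension `3`, `S ⊆ Bil(U) = (U →ₗ U →ₗ K)` a subspace STABLE under the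
derivation action of every `Z ∈ End(U)`: `β ↦ ((a, b) ↦ β(Za, b) + β(a, Zb))`.

* §1 `StableForms.sym_mem_of_apply_self_ne_zero` — if some `β ∈ S` has `β(u, u) ≠ 0`, then `S` contains every symmetrised product
  `φ ⊗ φ′ + φ′ ⊗ φ` (two rank-one derivations `φ ⊗ u`, `φ′ ⊗ u` with `φ(u) = 0` produce `β(u,u)·(φ ⊗ φ′ + φ′ ⊗ φ)`; a change of base vector
  reaches all pairs), hence EVERY symmetric form (`StableForms.mem_of_isSymm`).
* §2 `StableForms.wedge_mem_of_alternating` — if some ALTERNATING `α ∈ S` is non-zero, `S` contains every `φ ⊗ φ′ − φ′ ⊗ φ`, hence every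
  alternating form (`StableForms.mem_of_isAlt`).
* §3 **`StableForms.symm_or_antisymm_of_ne_top`** — a stable `S ≠ ⊤` consists of symmetric forms only, or of antisymmetric forms only
  (otherwise §1 puts `Sym ⊆ S`, the antisymmetric part of a non-symmetric member is then a non-zero alternating member, §2 puts `Alt ⊆ S`,
  and `Bil = Sym + Alt`).

USE (cell `pub-hodgeav-hg6`, eng-4 g7, brick S3-II of the (3|3) WEIL square, `Motives/HodgeLieWeilSquareNoTwistTwo`; honest framing of that
cell: HC / HC_AV / HC_CM / H2 NOT proved — this file is pure linear algebra): in the type-II twist of `WeilSquare.lift_or_twist` the forms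
`(p, p′) ↦ κ(p, M p′)` (`M` lowering) span a `𝔤𝔩(W⁺)`-stable subspace of `Bil(W⁺)`, which is therefore of ONE parity.

## References
* [GoodmanWallachGTM255] R. Goodman, N. R. Wallach, *Symmetry, Representations, and Invariants* (2009), §4.2.1, §5.5.2 (`⊗² = S² ⊕ Λ²`).
* [Humphreys1972] J. E. Humphreys, *Introduction to Lie Algebras and Representation Theory* (1972), §19.2.
-/

noncomputable section

namespace Literature.Algebra.Lie

open Module

variable {K : Type*} [Field K] {U : Type*} [AddCommGroup U] [Module K U]

/-! ### §0 Rank-one derivations of bilinear forms -/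

/-- The derivation action of the rank-one operator `φ ⊗ v` (`a ↦ φ(a)v`) on a bilinear form:
`β(φ(a)v, b) + β(a, φ(b)v) = φ(a)β(v, b) + β(a, v)φ(b)`. [cite: GoodmanWallachGTM255, §4.2.1] -/
theorem StableForms.act_smulRight (β : U →ₗ[K] U →ₗ[K] K) (φ : Module.Dual K U) (v : U) :
    β.compl₁₂ (φ.smulRight v) LinearMap.id + β.compl₂ (φ.smulRight v) = φ.smulRight (β v) + (β.flip v).smulRight φ := by
  refine LinearMap.ext fun a => LinearMap.ext fun b => ?_
  simp only [LinearMap.add_apply, LinearMap.compl₁₂_apply, LinearMap.compl₂_apply, LinearMap.id_apply, LinearMap.smulRight_apply,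
    map_smul, LinearMap.smul_apply, LinearMap.flip_apply, smul_eq_mul, mul_comm (φ b)]

/-- The derivation `φ′ ⊗ u` applied to a rank-one form `f ⊗ g` (`(a,b) ↦ f(a)g(b)`): `f(u)·φ′ ⊗ g + g(u)·f ⊗ φ′`.
[cite: GoodmanWallachGTM255, §4.2.1] -/
theorem StableForms.act_smulRight_smulRight (f g φ' : Module.Dual K U) (u : U) :
    (f.smulRight g).compl₁₂ (φ'.smulRight u) LinearMap.id + (f.smulRight g).compl₂ (φ'.smulRight u) =
      f u • φ'.smulRight g + g u • f.smulRight φ' := by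
  refine LinearMap.ext fun a => LinearMap.ext fun b => ?_
  simp only [LinearMap.add_apply, LinearMap.compl₁₂_apply, LinearMap.compl₂_apply, LinearMap.id_apply, LinearMap.smulRight_apply,
    map_smul, LinearMap.smul_apply, smul_eq_mul]
  ring

/-- The derivation action is additive in the form. [cite: GoodmanWallachGTM255, §4.2.1] -/
theorem StableForms.act_add (β β' : U →ₗ[K] U →ₗ[K] K) (Z : Module.End K U) :
    (β + β').compl₁₂ Z LinearMap.id + (β + β').compl₂ Z = (β.compl₁₂ Z LinearMap.id + β.compl₂ Z) + (β'.compl₁₂ Z LinearMap.id + β'.compl₂ Z) := by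
  refine LinearMap.ext fun a => LinearMap.ext fun b => ?_
  simp only [LinearMap.add_apply, LinearMap.compl₁₂_apply, LinearMap.compl₂_apply, LinearMap.id_apply]
  abel

/-- Expansion of a bilinear form in the rank-one forms of a basis: `β = Σ_{i,j} β(eᵢ, eⱼ) εᵢ ⊗ εⱼ`. [cite: GoodmanWallachGTM255, §4.2.1] -/
theorem StableForms.eq_sum_smulRight {ι : Type*} [Fintype ι] [DecidableEq ι] (b : Module.Basis ι K U) (β : U →ₗ[K] U →ₗ[K] K) :
    β = ∑ i, ∑ j, β (b i) (b j) • (b.coord i).smulRight (b.coord j) := by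
  refine LinearMap.ext_basis b b fun k l => ?_
  simp only [LinearMap.coe_sum, Finset.sum_apply, LinearMap.smul_apply, LinearMap.smulRight_apply, Module.Basis.coord_apply,
    Module.Basis.repr_self, Finsupp.single_apply, smul_eq_mul, mul_ite, mul_one, mul_zero, Finset.sum_ite_eq,
    Finset.mem_univ, if_true]

/-- The transposed expansion `Σ_{i,j} β(eᵢ, eⱼ) εⱼ ⊗ εᵢ = βᵀ`. [cite: GoodmanWallachGTM255, §4.2.1] -/
theorem StableForms.flip_eq_sum_smulRight {ι : Type*} [Fintype ι] [DecidableEq ι] (b : Module.Basis ι K U) (β : U →ₗ[K] U →ₗ[K] K) :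
    β.flip = ∑ i, ∑ j, β (b i) (b j) • (b.coord j).smulRight (b.coord i) := by
  rw [StableForms.eq_sum_smulRight b β.flip, Finset.sum_comm]
  simp only [LinearMap.flip_apply]

/-- A functional separating `y ∉ Kx` from `x`. Private plumbing. [folklore] -/
private theorem StableForms.exists_dual_eq_one_eq_zero {x y : U} (hy : y ∉ K ∙ x) : ∃ α : Module.Dual K U, α y = 1 ∧ α x = 0 := by
  obtain ⟨f, hfy, hfx⟩ := Submodule.exists_dual_map_eq_bot_of_notMem hy inferInstance
  have hfx0 : f x = 0 := by
    have h : f x ∈ Submodule.map f (K ∙ x) := Submodule.mem_map_of_mem (Submodule.mem_span_singleton_self x)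
    rw [hfx] at h
    exact (Submodule.mem_bot K).1 h
  refine ⟨(f y)⁻¹ • f, ?_, ?_⟩
  · rw [LinearMap.smul_apply, smul_eq_mul, inv_mul_cancel₀ hfy]
  · rw [LinearMap.smul_apply, hfx0, smul_zero]

/-- The kernel of a non-zero functional on a `3`-space is not contained in a line. Private plumbing. [folklore] -/
private theorem StableForms.exists_mem_ker_not_mem_span [FiniteDimensional K U] (h3 : Module.finrank K U = 3)
    {φ : Module.Dual K U} (hφ : φ ≠ 0) (u : U) : ∃ u', φ u' = 0 ∧ u' ∉ K ∙ u := by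
  obtain ⟨x, hx⟩ : ∃ x, φ x ≠ 0 := by
    by_contra h
    push Not at h
    exact hφ (LinearMap.ext h)
  have hrange : LinearMap.range φ = ⊤ := LinearMap.range_eq_top.2 fun c =>
    ⟨(c / φ x) • x, by rw [map_smul, smul_eq_mul, div_mul_cancel₀ c hx]⟩
  have hker : Module.finrank K ↥(LinearMap.ker φ) = 2 := by
    have h := LinearMap.finrank_range_add_finrank_ker φ
    rw [hrange, finrank_top, Module.finrank_self, h3] at h
    omega
  by_contra hcon
  push Not at hcon
  have hle : LinearMap.ker φ ≤ K ∙ u := fun y hy => hcon y (LinearMap.mem_ker.1 hy)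
  have h1 := Submodule.finrank_mono hle
  have h2 : Module.finrank K ↥(K ∙ u) ≤ 1 := (finrank_span_le_card ({u} : Set U)).trans (by simp)
  omega

/-! ### §1 A member with `β(u, u) ≠ 0` generates all symmetric forms -/

section Stable

variable {S : Submodule K (U →ₗ[K] U →ₗ[K] K)}
  (hS : ∀ (Z : Module.End K U), ∀ β ∈ S, β.compl₁₂ Z LinearMap.id + β.compl₂ Z ∈ S)
include hS

/-- Two rank-one derivations through `u` turn `β` with `β(u,u) ≠ 0` into `β(u,u)·(φ ⊗ φ′ + φ′ ⊗ φ)` for `φ(u) = 0`.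
[cite: GoodmanWallachGTM255, §5.5.2] -/
theorem StableForms.sym_mem_of_apply_self_ne_zero_of_apply_eq_zero {β : U →ₗ[K] U →ₗ[K] K} (hβ : β ∈ S) {u : U} (hu : β u u ≠ 0)
    {φ : Module.Dual K U} (hφ : φ u = 0) (φ' : Module.Dual K U) : φ.smulRight φ' + φ'.smulRight φ ∈ S := by
  have h1 : φ.smulRight (β u) + (β.flip u).smulRight φ ∈ S := by rw [← StableForms.act_smulRight]; exact hS _ β hβ
  have h2 := hS (φ'.smulRight u) _ h1
  rw [StableForms.act_add, StableForms.act_smulRight_smulRight, StableForms.act_smulRight_smulRight, hφ, zero_smul, zero_add, zero_smul,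
    add_zero, LinearMap.flip_apply] at h2
  have h3 := S.smul_mem (β u u)⁻¹ h2
  rwa [smul_add, smul_smul, smul_smul, inv_mul_cancel₀ hu, one_smul, one_smul] at h3

/-- **If some `β ∈ S` has `β(u,u) ≠ 0`, every `φ₁ ⊗ φ₂ + φ₂ ⊗ φ₁` lies in `S`** (`dim U = 3`). [cite: GoodmanWallachGTM255, §5.5.2] -/
theorem StableForms.sym_mem_of_apply_self_ne_zero [CharZero K] [FiniteDimensional K U] (h3 : Module.finrank K U = 3) {β : U →ₗ[K] U →ₗ[K] K}
    (hβ : β ∈ S) {u : U} (hu : β u u ≠ 0) (φ₁ φ₂ : Module.Dual K U) : φ₁.smulRight φ₂ + φ₂.smulRight φ₁ ∈ S := by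
  by_cases hφ₁ : φ₁ = 0
  · rw [hφ₁]
    have h : (0 : Module.Dual K U).smulRight φ₂ + φ₂.smulRight (0 : Module.Dual K U) = 0 :=
      LinearMap.ext fun a => by rw [LinearMap.add_apply, LinearMap.smulRight_apply, LinearMap.smulRight_apply, LinearMap.zero_apply,
        zero_smul, smul_zero, zero_add, LinearMap.zero_apply]
    rw [h]
    exact S.zero_mem
  -- a new base vector `u' ∈ ker φ₁` off the line `Ku`, and `φ` with `φ(u) = 0`, `φ(u') = 1`
  obtain ⟨u', hφ₁u', hu'⟩ := StableForms.exists_mem_ker_not_mem_span h3 hφ₁ u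
  obtain ⟨φ, hφu', hφu⟩ := StableForms.exists_dual_eq_one_eq_zero hu'
  have hb : φ.smulRight φ + φ.smulRight φ ∈ S := StableForms.sym_mem_of_apply_self_ne_zero_of_apply_eq_zero hS hβ hu hφu φ
  have hb' : (φ.smulRight φ + φ.smulRight φ) u' u' ≠ 0 := by
    rw [LinearMap.add_apply, LinearMap.add_apply, LinearMap.smulRight_apply, LinearMap.smul_apply, hφu', smul_eq_mul, one_mul]
    norm_num
  exact StableForms.sym_mem_of_apply_self_ne_zero_of_apply_eq_zero hS hb hb' hφ₁u' φ₂

/-- **If some `β ∈ S` has `β(u,u) ≠ 0`, `S` contains every symmetric form** (`char K = 0`, `dim U = 3`).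
[cite: GoodmanWallachGTM255, §5.5.2] -/
theorem StableForms.mem_of_isSymm [CharZero K] [FiniteDimensional K U] (h3 : Module.finrank K U = 3) {β : U →ₗ[K] U →ₗ[K] K}
    (hβ : β ∈ S) {u : U} (hu : β u u ≠ 0) {σ : U →ₗ[K] U →ₗ[K] K} (hσ : ∀ a b, σ a b = σ b a) : σ ∈ S := by
  classical
  let b := Module.finBasisOfFinrankEq K U h3
  have hexp := StableForms.eq_sum_smulRight b σ
  have hexp' := StableForms.flip_eq_sum_smulRight b σ
  have hflip : σ.flip = σ := LinearMap.ext fun a => LinearMap.ext fun c => by rw [LinearMap.flip_apply, hσ]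
  rw [hflip] at hexp'
  have h2 : (2 : K) • σ = ∑ i, ∑ j, σ (b i) (b j) • ((b.coord i).smulRight (b.coord j) + (b.coord j).smulRight (b.coord i)) := by
    calc (2 : K) • σ = (∑ i, ∑ j, σ (b i) (b j) • (b.coord i).smulRight (b.coord j)) +
          ∑ i, ∑ j, σ (b i) (b j) • (b.coord j).smulRight (b.coord i) := by
            rw [two_smul]; exact congrArg₂ (· + ·) hexp hexp'
      _ = _ := by
        rw [← Finset.sum_add_distrib]
        refine Finset.sum_congr rfl fun i _ => ?_
        rw [← Finset.sum_add_distrib]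
        refine Finset.sum_congr rfl fun j _ => ?_
        rw [smul_add]
  have hmem : (2 : K) • σ ∈ S := by
    rw [h2]
    exact S.sum_mem fun i _ => S.sum_mem fun j _ => S.smul_mem _ (StableForms.sym_mem_of_apply_self_ne_zero hS h3 hβ hu _ _)
  have h := S.smul_mem (2 : K)⁻¹ hmem
  rwa [smul_smul, inv_mul_cancel₀ (two_ne_zero' K), one_smul] at h

/-! ### §2 A non-zero alternating member generates all alternating forms -/

/-- Two rank-one derivations turn an alternating `α` with `α(a₀, b₀) ≠ 0` into `α(a₀,b₀)·(φ ⊗ φ′ − φ′ ⊗ φ)` for `φ(b₀) = 0`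
(differences written as `x + (−1)·y`). [cite: GoodmanWallachGTM255, §5.5.2] -/
theorem StableForms.wedge_mem_of_alternating_of_apply_eq_zero {α : U →ₗ[K] U →ₗ[K] K} (hα : α ∈ S) (halt : ∀ a b, α a b = -α b a)
    {a₀ b₀ : U} (h0 : α a₀ b₀ ≠ 0) {φ : Module.Dual K U} (hφ : φ b₀ = 0) (φ' : Module.Dual K U) :
    φ.smulRight φ' + (-1 : K) • φ'.smulRight φ ∈ S := by
  have h1 : φ.smulRight (α a₀) + (α.flip a₀).smulRight φ ∈ S := by rw [← StableForms.act_smulRight]; exact hS _ α hα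
  have h2 := hS (φ'.smulRight b₀) _ h1
  rw [StableForms.act_add, StableForms.act_smulRight_smulRight, StableForms.act_smulRight_smulRight, hφ, zero_smul, zero_add, zero_smul,
    add_zero, LinearMap.flip_apply, halt b₀ a₀] at h2
  have h3 := S.smul_mem (α a₀ b₀)⁻¹ h2
  rwa [smul_add, smul_smul, smul_smul, inv_mul_cancel₀ h0, one_smul, mul_neg, inv_mul_cancel₀ h0] at h3

/-- **A non-zero alternating member puts every `φ₁ ⊗ φ₂ − φ₂ ⊗ φ₁` in `S`.** [cite: GoodmanWallachGTM255, §5.5.2] -/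
theorem StableForms.wedge_mem_of_alternating {α : U →ₗ[K] U →ₗ[K] K} (hα : α ∈ S) (halt : ∀ a b, α a b = -α b a)
    {a₀ b₀ : U} (h0 : α a₀ b₀ ≠ 0) (φ₁ φ₂ : Module.Dual K U) : φ₁.smulRight φ₂ + (-1 : K) • φ₂.smulRight φ₁ ∈ S := by
  by_cases h1 : φ₁ b₀ = 0
  · exact StableForms.wedge_mem_of_alternating_of_apply_eq_zero hS hα halt h0 h1 φ₂
  -- `φ₃ = φ₂ − t φ₁` with `φ₃(b₀) = 0`; `φ₁ ∧ φ₂ = −(φ₃ ∧ φ₁)`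
  set t : K := φ₂ b₀ / φ₁ b₀ with ht
  have hφ₃0 : (φ₂ - t • φ₁) b₀ = 0 := by rw [LinearMap.sub_apply, LinearMap.smul_apply, smul_eq_mul, ht, div_mul_cancel₀ _ h1, sub_self]
  have h := S.smul_mem (-1 : K) (StableForms.wedge_mem_of_alternating_of_apply_eq_zero hS hα halt h0 hφ₃0 φ₁)
  have heq : (-1 : K) • ((φ₂ - t • φ₁).smulRight φ₁ + (-1 : K) • φ₁.smulRight (φ₂ - t • φ₁)) =
      φ₁.smulRight φ₂ + (-1 : K) • φ₂.smulRight φ₁ :=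
    LinearMap.ext fun a => LinearMap.ext fun c => by
      simp only [LinearMap.smul_apply, LinearMap.add_apply, LinearMap.sub_apply, LinearMap.smulRight_apply, smul_eq_mul]
      ring
  rwa [heq] at h

/-- **A non-zero alternating member puts every antisymmetric form in `S`** (`char K = 0`, `dim U = 3`).
[cite: GoodmanWallachGTM255, §5.5.2] -/
theorem StableForms.mem_of_isAlt [CharZero K] [FiniteDimensional K U] (h3 : Module.finrank K U = 3) {α : U →ₗ[K] U →ₗ[K] K}
    (hα : α ∈ S) (halt : ∀ a b, α a b = -α b a) {a₀ b₀ : U} (h0 : α a₀ b₀ ≠ 0) {α' : U →ₗ[K] U →ₗ[K] K}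
    (halt' : ∀ a b, α' a b = -α' b a) : α' ∈ S := by
  classical
  let b := Module.finBasisOfFinrankEq K U h3
  have hexp := StableForms.eq_sum_smulRight b α'
  have hexp' := StableForms.flip_eq_sum_smulRight b α'
  have hflip : α' = (-1 : K) • α'.flip := LinearMap.ext fun a => LinearMap.ext fun c => by
    rw [LinearMap.smul_apply, LinearMap.smul_apply, LinearMap.flip_apply, halt', smul_eq_mul, neg_one_mul]
  have hB : α' = ∑ i, ∑ j, α' (b i) (b j) • ((-1 : K) • (b.coord j).smulRight (b.coord i)) := by
    calc α' = (-1 : K) • α'.flip := hflip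
      _ = (-1 : K) • ∑ i, ∑ j, α' (b i) (b j) • (b.coord j).smulRight (b.coord i) := by rw [hexp']
      _ = _ := by
        rw [Finset.smul_sum]
        refine Finset.sum_congr rfl fun i _ => ?_
        rw [Finset.smul_sum]
        refine Finset.sum_congr rfl fun j _ => ?_
        rw [smul_comm]
  have h2 : (2 : K) • α' = ∑ i, ∑ j, α' (b i) (b j) • ((b.coord i).smulRight (b.coord j) + (-1 : K) • (b.coord j).smulRight (b.coord i)) := by
    calc (2 : K) • α' = (∑ i, ∑ j, α' (b i) (b j) • (b.coord i).smulRight (b.coord j)) +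
          ∑ i, ∑ j, α' (b i) (b j) • ((-1 : K) • (b.coord j).smulRight (b.coord i)) := by
            rw [two_smul]; exact congrArg₂ (· + ·) hexp hB
      _ = _ := by
        rw [← Finset.sum_add_distrib]
        refine Finset.sum_congr rfl fun i _ => ?_
        rw [← Finset.sum_add_distrib]
        refine Finset.sum_congr rfl fun j _ => ?_
        rw [smul_add]
  have hmem : (2 : K) • α' ∈ S := by
    rw [h2]
    exact S.sum_mem fun i _ => S.sum_mem fun j _ => S.smul_mem _ (StableForms.wedge_mem_of_alternating hS hα halt h0 _ _)
  have h := S.smul_mem (2 : K)⁻¹ hmem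
  rwa [smul_smul, inv_mul_cancel₀ (two_ne_zero' K), one_smul] at h

/-! ### §3 The parity dichotomy -/

/-- **A `𝔤𝔩(U)`-stable subspace of bilinear forms on a `3`-space, other than everything, is all-symmetric or all-antisymmetric**
(`char K = 0`). If some member is not alternating, §1 gives `Sym ⊆ S`; if moreover some member `β₂` is not symmetric, its
antisymmetric part `β₂ − ½(β₂ + β₂ᵀ) ∈ S` is a non-zero alternating member, §2 gives `Alt ⊆ S`, and `S ⊇ Sym + Alt = Bil(U)`.
[cite: GoodmanWallachGTM255, §5.5.2] [cite: Humphreys1972, §19.2] -/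
theorem StableForms.symm_or_antisymm_of_ne_top [CharZero K] [FiniteDimensional K U] (h3 : Module.finrank K U = 3) (hS' : S ≠ ⊤) :
    (∀ β ∈ S, ∀ a b, β a b = β b a) ∨ (∀ β ∈ S, ∀ a b, β a b = -β b a) := by
  by_cases hA : ∀ β ∈ S, ∀ u, β u u = 0
  · right
    intro β hβ a c
    have h := hA β hβ (a + c)
    simp only [map_add, LinearMap.add_apply, hA β hβ a, hA β hβ c, zero_add, add_zero] at h
    rw [add_comm] at h
    exact eq_neg_of_add_eq_zero_left h
  push Not at hA
  obtain ⟨β₁, hβ₁, u, hu⟩ := hA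
  by_cases hB : ∀ β ∈ S, ∀ a b, β a b = β b a
  · exact Or.inl hB
  exfalso
  push Not at hB
  obtain ⟨β₂, hβ₂, a₀, b₀, hne⟩ := hB
  -- the symmetric part of `β₂` lies in `S` (§1), so does the antisymmetric part
  have hsym : ∀ {σ : U →ₗ[K] U →ₗ[K] K}, (∀ a b, σ a b = σ b a) → σ ∈ S := fun hσ => StableForms.mem_of_isSymm hS h3 hβ₁ hu hσ
  have hσ₂ : β₂ + β₂.flip ∈ S := hsym (σ := β₂ + β₂.flip) fun a c => by
    simp only [LinearMap.add_apply, LinearMap.flip_apply]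
    exact add_comm _ _
  have hαS : β₂ + (-(2 : K)⁻¹) • (β₂ + β₂.flip) ∈ S := S.add_mem hβ₂ (S.smul_mem _ hσ₂)
  have hαapply : ∀ a c, (β₂ + (-(2 : K)⁻¹) • (β₂ + β₂.flip)) a c = (2 : K)⁻¹ * (β₂ a c - β₂ c a) := fun a c => by
    simp only [LinearMap.add_apply, LinearMap.smul_apply, LinearMap.flip_apply, smul_eq_mul]
    field_simp
    ring
  have halt : ∀ a c, (β₂ + (-(2 : K)⁻¹) • (β₂ + β₂.flip)) a c = -(β₂ + (-(2 : K)⁻¹) • (β₂ + β₂.flip)) c a := fun a c => by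
    rw [hαapply, hαapply]; ring
  have h0 : (β₂ + (-(2 : K)⁻¹) • (β₂ + β₂.flip)) a₀ b₀ ≠ 0 := by
    rw [hαapply]
    exact mul_ne_zero (inv_ne_zero (two_ne_zero' K)) (sub_ne_zero.2 hne)
  have halt' : ∀ {α' : U →ₗ[K] U →ₗ[K] K}, (∀ a b, α' a b = -α' b a) → α' ∈ S := fun hα' =>
    StableForms.mem_of_isAlt hS h3 hαS halt h0 hα'
  -- every form is symmetric part plus antisymmetric part
  refine hS' (Submodule.eq_top_iff'.2 fun β => ?_)
  have hs : β + β.flip ∈ S := hsym (σ := β + β.flip) fun a c => by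
    simp only [LinearMap.add_apply, LinearMap.flip_apply]
    exact add_comm _ _
  have ha : β + (-1 : K) • β.flip ∈ S := halt' (α' := β + (-1 : K) • β.flip) fun a c => by
    simp only [LinearMap.add_apply, LinearMap.smul_apply, LinearMap.flip_apply, smul_eq_mul]
    ring
  have h := S.add_mem (S.smul_mem (2 : K)⁻¹ hs) (S.smul_mem (2 : K)⁻¹ ha)
  have heq : (2 : K)⁻¹ • (β + β.flip) + (2 : K)⁻¹ • (β + (-1 : K) • β.flip) = β :=
    LinearMap.ext fun a => LinearMap.ext fun c => by
      simp only [LinearMap.add_apply, LinearMap.smul_apply, LinearMap.flip_apply, smul_eq_mul]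
      ring
  rwa [heq] at h

end Stable

end Literature.Algebra.Lie

end
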